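import Literature.AnabelianGeometry.AbsoluteAnabelian.AbsTopIII.FrobeniusPictureMLFTelecoreProofs
import Literature.AnabelianGeometry.AbsoluteAnabelian.AbsTopIII.FrobeniusPictureMLFNexusProofs
import Literature.AnabelianGeometry.AbsoluteAnabelian.AnabCategory

/-!
# [AbsTopIII] Corollary 3.6 at the printed shape of its inputs: `Anab`, `κ_An`, `π_An`, `φ_An` real

S. Mochizuki, *Topics in Absolute Anabelian Geometry III*, Def. 3.1 (iii), (iv), (vi) pp. 67–70 and
Cor. 3.6 pp. 78–80 of the kurims manuscript (`paper:url-5493eb38cbb7`; bib key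
`MochizukiAbsTopIII2015`).  Block W2-B1 of the abc-iut cell (node `AbsTopIII:Cor3.6(ii)` and the
assembled Cor. 3.6 (i)–(v)); companion of `AbsTopIII/FrobeniusPictureMLF.lean` /
`FrobeniusPictureMLFTelecore.lean` (typed statements over the abstract input data
`LogFrobeniusData` of `LogFrobeniusDiagram.lean`, seat abc-iut-L4-t2) and of the discharge files
`FrobeniusPictureMLFCores` / `…Shift` / `…Incompatibility` / `…TelecoreProofs` / `…NexusProofs`.

## What this file does

In the abstraction `LogFrobeniusData` the first row of `𝒟` is a separate category `X₁` with an edge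
functor `toNexus = id_⋎ : X₁ ⥤ 𝒳` (so that Cor. 3.7's `𝒳 ×_ℰ 𝒳`, `pr_⋎` fit the same record), the
category `Anab` is an abstract field `A`, and the printed clause of Cor. 3.6 (ii) "`φ_An` … which is
an equivalence of categories, a quasi-inverse for which is given by the composite `π_An : 𝒳 → Anab`
of the natural projection functor `𝒳 → ℰ` with `κ_An : ℰ → Anab`" together with
"`η_An : φ_An ∘ π_An ⥲ id_𝒳`" are DATA of the record (`φ_equiv`, `η`), i.e. assumed.  Here we take
one step towards the printed instance:

* `MonoAnabelianLogFrobeniusData` — the input data IN THE SHAPE DEF. 3.1 GIVES IT: the categories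
  `𝒳 = 𝒞^{MLF-sB}_T`, `𝒩 = 𝒞^{MLF-sB}_{TS}`, `ℰ = 𝒯𝒢^{sB}` with the functors `log`, `λ^×`, `λ^{×pf}`,
  `ι_log`, `ι_×` of Def. 3.1 (iv) (abstract fields here; their instantiation by the real categories
  and functors of `MLFGaloisCategories.lean` and the Def. 3.1 (iii)/(iv) functor files is a separate,
  short file), and the ONE anabelian input isolated as a pair: the "group-theoretic" algorithm of
  Cor. 1.10 (d), (h) as a functor `alg : ℰ ⥤ 𝒟` (valued in a category `𝒟` of the data
  "`Π ↷ {k̄^× ↪ lim→_J H¹(J, μ_Ẑ(Π))}` … equipped with its topological field structure and natural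
  action via `Π`", Def. 3.1 (vi)) with the printed assignment `forget : 𝒟 ⥤ 𝒳` of Cor. 3.6 (ii)
  ("`(Π, Π ↷ {…}) ↦ (Π ↷ 𝒪^⊳_k̄), (Π ↷ k̄^× ∪ {0})`"), lying over `ℰ` (`algOver`), and the Kummer
  comparison `ηAn : (𝒳 → ℰ) ⋙ alg ⋙ forget ≅ 𝟭_𝒳` "arising from the 'group-theoretic' algorithms of
  Corollary 1.10 [cf. also Proposition 3.2, (ii), (iii)]" (p. 79).
* Over it, REAL constructions: `Anab := Anab alg` and `κ_An`, `Anab → 𝒯𝒢^{sB}` (file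
  `AnabCategory.lean`, seat abc-iut-L4-t2: Def. 3.1 (vi) with "`κ_An` … is an equivalence" PROVED),
  `φ_An := proj ⋙ alg ⋙ forget`, `π_An := (𝒳 → ℰ) ⋙ κ_An`; **`φ_An` is an equivalence with
  quasi-inverse `π_An` — PROVED** (`φAnEquivalence`, from `ηAn`, `algOver` and the equivalence
  `κ_An`); the `LogFrobeniusData` with `X₁ = 𝒳`, `id_⋎ = 𝟭_𝒳` (`toLogFrobeniusData`); the printed
  first-row telecore datum `τ = ⟨φ_An, 𝟙, η_An⟩` (`telecoreData`).
* Consequences: **Cor. 3.6 (ii) `TelecoreStmt` holds UNCONDITIONALLY at this shape**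
  (`telecoreStmt`; the two hypotheses of `LogFrobeniusData.telecoreStmt_of_coherent` — `id_⋎` fully
  faithful, `τ` coherent — are automatic), likewise Cor. 4.5 (ii) in the same typed form
  (`cor_4_5_ii`); and the assembled Cor. 3.6 (i)–(v) `LogFrobeniusCompatible` holds given EXACTLY
  the two printed model inputs by name — the Lemma-3.4 property of `ι_×` (Lemma 3.4, p. 77) and the
  id-rigidity of `𝒳 = 𝒞^{MLF-sB}_T` (Prop. 3.2 (iv), p. 72: "the categories … `𝒞^{MLF-sB}_T` … are
  id-rigid") — and an object of `𝒳` (`logFrobeniusCompatible`).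

HONEST FRAMING: a construction and formal verifications over named inputs; the anabelian content is
the parameter pair (`alg`, `ηAn`), i.e. Cor. 1.10 / Prop. 3.2 (ii)(iii), which is NOT asserted here;
nothing in this file bears on [IUTchIII] Cor. 3.12 or takes a side; typed ≠ discharged.
-/

namespace Literature.AnabelianGeometry.AbsoluteAnabelian

open _root_.CategoryTheory _root_.Quiver

universe u

/-- **The input data of Cor. 3.6 in the shape of Def. 3.1** ("Write `𝒳 := 𝒞^{MLF-sB}_T`;
`ℰ := 𝒯𝒢^{sB}`; `𝒩 := 𝒞^{MLF-sB}_{TS}` — where [in the notation of Definition 3.1] `T ∈ {TM, TF}`",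
Cor. 3.6 p. 78): the three categories with
the projections `(Π ↷ M) ↦ Π` (Def. 3.1 (iii)); the log-Frobenius functor `log = log_{T,T}`,
"isomorphic to the identity functor" (Def. 3.1 (iv), Prop. 3.2 (v)); `λ^×, λ^{×pf} : 𝒳 → 𝒩` with
`ι_log : λ^× ∘ log → λ^{×pf}` and `ι_×` (Def. 3.1 (iv); `ι_×` carries the direction flag of
`LogFrobeniusData.ιtimes`, left = the present §3 direction `λ^× → λ^{×pf}`, right = Cor. 4.5's);
and the anabelian input: a category `𝒟` for the data "`Π ↷ {k̄^× ↪ lim→_J H¹(J, μ_Ẑ(Π))}` … equipped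
with its topological field structure and natural action via `Π`", the "group-theoretic" algorithm
of Cor. 1.10 (d), (h) producing it as a functor `alg : ℰ ⥤ 𝒟` (Def. 3.1 (vi), Rmk. 3.1.2), the
assignment "`(Π, Π ↷ {…}) ↦ (Π ↷ 𝒪^⊳_k̄), (Π ↷ k̄^× ∪ {0})`" of Cor. 3.6 (ii) as a functor
`forget : 𝒟 ⥤ 𝒳` whose composite with `alg` lies over `ℰ` (`algOver`; in print the underlying
group of `alg(Π)` IS `Π`), and the isomorphism "`η_An` … arising from the 'group-theoretic'
algorithms of Corollary 1.10 [cf. also Proposition 3.2, (ii), (iii)]" comparing an object `x` of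
`𝒳` with the pair reconstructed from its Galois group (`ηAn`).
[cite: MochizukiAbsTopIII2015, Corollary 3.6 (ii) pp.78–79] -/
structure MonoAnabelianLogFrobeniusData : Type (u + 1) where
  /-- `𝒳 = 𝒞^{MLF-sB}_T`. -/
  X : Type u
  [catX : Category.{u} X]
  /-- `𝒩 = 𝒞^{MLF-sB}_{TS}`. -/
  N : Type u
  [catN : Category.{u} N]
  /-- `ℰ = 𝒯𝒢^{sB}`. -/
  E : Type u
  [catE : Category.{u} E]
  /-- `𝒟`: the category of the data `Π ↷ {k̄^× ↪ lim→_J H¹(J, μ_Ẑ(Π))}` with field structure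
  (Def. 3.1 (vi)); for `T = TF` one may take `𝒟 = 𝒳`, `forget = 𝟭`. -/
  D : Type u
  [catD : Category.{u} D]
  /-- `𝒳 → ℰ`, `(Π ↷ M) ↦ Π` (Def. 3.1 (iii)). -/
  XtoE : X ⥤ E
  /-- `𝒩 → ℰ`. -/
  NtoE : N ⥤ E
  /-- `log = log_{T,T} : 𝒳 → 𝒳` (Def. 3.1 (iv), Prop. 3.2 (v)). -/
  log : X ⥤ X
  /-- "the functor `log_{T,T}` is isomorphic to the identity functor" (Prop. 3.2 (v)). -/
  logIsoId : log ≅ 𝟭 X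
  /-- `λ^× : 𝒳 → 𝒩` (Def. 3.1 (iv)). -/
  lamTimes : X ⥤ N
  /-- `λ^{×pf} : 𝒳 → 𝒩` (Def. 3.1 (iv)). -/
  lamPf : X ⥤ N
  /-- `λ^×` lies over `ℰ`. -/
  lamTimes_NtoE : lamTimes ⋙ NtoE = XtoE
  /-- `λ^{×pf}` lies over `ℰ`. -/
  lamPf_NtoE : lamPf ⋙ NtoE = XtoE
  /-- `ι_log : λ^× ∘ log_{TF,TF} → λ^{×pf}` (Def. 3.1 (iv)). -/
  ιlog : log ⋙ lamTimes ⟶ lamPf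
  /-- `ι_× : λ^× → λ^{×pf}` (left; Def. 3.1 (iv)) — resp. `λ^∼ → λ^×` (right; Def. 4.1 (iv)). -/
  ιtimes : (lamTimes ⟶ lamPf) ⊕ (lamPf ⟶ lamTimes)
  /-- The "group-theoretic" algorithm of Cor. 1.10 (d), (h): `Π ↦ (Π ↷ {k̄^× ↪ lim→_J H¹(J, μ_Ẑ(Π))})`
  (Def. 3.1 (vi)). -/
  alg : E ⥤ D
  /-- The assignment `(Π, Π ↷ {…}) ↦ (Π ↷ 𝒪^⊳_k̄), (Π ↷ k̄^× ∪ {0})` of Cor. 3.6 (ii). -/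
  forget : D ⥤ X
  /-- The pair produced from `Π` has underlying group `Π` (an isomorphism here; the identity in
  print). -/
  algOver : (alg ⋙ forget) ⋙ XtoE ≅ 𝟭 E
  /-- The comparison `φ_An(π_An(x)) ⥲ x` "arising from the 'group-theoretic' algorithms of Corollary
  1.10 [cf. also Proposition 3.2, (ii), (iii)]" (Cor. 3.6 (ii) p. 79). -/
  ηAn : XtoE ⋙ (alg ⋙ forget) ≅ 𝟭 X

attribute [instance] MonoAnabelianLogFrobeniusData.catX MonoAnabelianLogFrobeniusData.catN
  MonoAnabelianLogFrobeniusData.catE MonoAnabelianLogFrobeniusData.catD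

namespace MonoAnabelianLogFrobeniusData

variable (𝔐 : MonoAnabelianLogFrobeniusData.{u})

/-! ### `φ_An`, `π_An` and the equivalence (Cor. 3.6 (ii), first clauses) -/

/-- **`φ_An : Anab → 𝒳`**, the "natural “forgetful” functor" determined by the assignment
`(Π, Π ↷ {k̄^× ↪ lim→_J H¹(J, μ_Ẑ(Π))}) ↦ (Π ↷ 𝒪^⊳_k̄), (Π ↷ k̄^× ∪ {0})`: on `Anab alg` (objects
`(Π, alg(Π))`, Def. 3.1 (vi)) it is the datum functor followed by `forget`.
[cite: MochizukiAbsTopIII2015, Corollary 3.6 (ii) p.79] -/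
def φAn : Anab 𝔐.alg ⥤ 𝔐.X := Anab.proj 𝔐.alg ⋙ (𝔐.alg ⋙ 𝔐.forget)

/-- **`π_An : 𝒳 → Anab`**, "the composite … of the natural projection functor `𝒳 → ℰ` with
`κ_An : ℰ → Anab`". [cite: MochizukiAbsTopIII2015, Corollary 3.6 (ii) p.79] -/
def πAn : 𝔐.X ⥤ Anab 𝔐.alg := 𝔐.XtoE ⋙ Anab.κAn 𝔐.alg

/-- `φ_An` is the datum functor of `Anab` followed by `forget`. [cite: MochizukiAbsTopIII2015, Corollary 3.6 (ii) p.79] -/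
theorem φAn_eq : 𝔐.φAn = Anab.dataFunctor 𝔐.alg ⋙ 𝔐.forget := rfl

/-- **`η_An : φ_An ∘ π_An ⥲ id_𝒳`** — componentwise the input comparison `ηAn`
(`π_An ⋙ φ_An = (𝒳 → ℰ) ⋙ alg ⋙ forget` on the nose, since `κ_An ⋙ proj = 𝟭`).
[cite: MochizukiAbsTopIII2015, Corollary 3.6 (ii) p.79] -/
def ηφπ : 𝔐.πAn ⋙ 𝔐.φAn ≅ 𝟭 𝔐.X :=
  NatIso.ofComponents (fun x => 𝔐.ηAn.app x) (fun f => 𝔐.ηAn.hom.naturality f)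

/-- Components of `η_An`. [cite: MochizukiAbsTopIII2015, Corollary 3.6 (ii) p.79] -/
@[simp] theorem ηφπ_hom_app (x : 𝔐.X) : 𝔐.ηφπ.hom.app x = 𝔐.ηAn.hom.app x := rfl

/-- Components of `η_An⁻¹`. [cite: MochizukiAbsTopIII2015, Corollary 3.6 (ii) p.79] -/
@[simp] theorem ηφπ_inv_app (x : 𝔐.X) : 𝔐.ηφπ.inv.app x = 𝔐.ηAn.inv.app x := rfl

/-- The unit `(Π, alg Π) ≅ π_An(φ_An(Π, alg Π))` of the equivalence: the identity-induced morphism of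
`Anab` over `algOver⁻¹`. [cite: MochizukiAbsTopIII2015, Corollary 3.6 (ii) p.79] -/
def unitAnApp (P : Anab 𝔐.alg) : P ≅ (𝔐.φAn ⋙ 𝔐.πAn).obj P where
  hom := ⟨𝔐.algOver.inv.app P.grp⟩
  inv := ⟨𝔐.algOver.hom.app P.grp⟩
  hom_inv_id := Anab.Hom.ext (𝔐.algOver.inv_hom_id_app P.grp)
  inv_hom_id := Anab.Hom.ext (𝔐.algOver.hom_inv_id_app P.grp)

/-- The unit `𝟭_Anab ≅ φ_An ⋙ π_An`, natural by the naturality of `algOver`.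
[cite: MochizukiAbsTopIII2015, Corollary 3.6 (ii) p.79] -/
def unitAn : 𝟭 (Anab 𝔐.alg) ≅ 𝔐.φAn ⋙ 𝔐.πAn :=
  NatIso.ofComponents (fun P => 𝔐.unitAnApp P) (fun {P Q} f => Anab.Hom.ext (by
    change f.hom ≫ 𝔐.algOver.inv.app Q.grp =
      𝔐.algOver.inv.app P.grp ≫ 𝔐.XtoE.map (𝔐.forget.map (𝔐.alg.map f.hom))
    exact 𝔐.algOver.inv.naturality f.hom))

/-- **Cor. 3.6 (ii): "`φ_An` … is an equivalence of categories, a quasi-inverse for which is given by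
… `π_An`" — PROVED** over the inputs (`ηAn` gives `π_An ⋙ φ_An ≅ 𝟭`; `algOver` and the equivalence
`κ_An` of Def. 3.1 (vi) give `φ_An ⋙ π_An ≅ 𝟭`). [cite: MochizukiAbsTopIII2015, Corollary 3.6 (ii) p.79] -/
def φAnEquivalence : Anab 𝔐.alg ≌ 𝔐.X :=
  CategoryTheory.Equivalence.mk 𝔐.φAn 𝔐.πAn 𝔐.unitAn 𝔐.ηφπ

/-- The functor of `φAnEquivalence` is `φ_An`. [cite: MochizukiAbsTopIII2015, Corollary 3.6 (ii) p.79] -/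
theorem φAnEquivalence_functor : 𝔐.φAnEquivalence.functor = 𝔐.φAn := rfl

/-- The quasi-inverse of `φAnEquivalence` is `π_An` ("a quasi-inverse for which is given by … `π_An`").
[cite: MochizukiAbsTopIII2015, Corollary 3.6 (ii) p.79] -/
theorem φAnEquivalence_inverse : 𝔐.φAnEquivalence.inverse = 𝔐.πAn := rfl

/-- `φ_An` is an equivalence. [cite: MochizukiAbsTopIII2015, Corollary 3.6 (ii) p.79] -/
theorem φAn_isEquivalence : 𝔐.φAn.IsEquivalence := 𝔐.φAnEquivalence.isEquivalence_functor

/-! ### The `LogFrobeniusData` with `X₁ = 𝒳`, `id_⋎ = 𝟭`, and the printed telecore datum -/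

/-- **The input data of Cor. 3.6 as a `LogFrobeniusData`**: first row = `𝒳` itself, `id_⋎` "the
identity functor at the vertex `⋎ ∈ L`" (p. 79), `Anab := Anab alg` with `κ_An` and the projection
`Anab → ℰ` of Def. 3.1 (vi) (its equivalence PROVED there), `φ_An`, `η_An` as above (equivalence
PROVED here). [cite: MochizukiAbsTopIII2015, Corollary 3.6 pp.78–79] -/
def toLogFrobeniusData : LogFrobeniusData.{u} where
  X₁ := 𝔐.X
  X := 𝔐.X
  toNexus := 𝟭 𝔐.X
  N := 𝔐.N
  E := 𝔐.E
  A := Anab 𝔐.alg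
  log := 𝔐.log
  logIsoId := 𝔐.logIsoId
  lamTimes := 𝔐.lamTimes
  lamPf := 𝔐.lamPf
  ιlog := { app := fun x => 𝔐.ιlog.app x, naturality := fun _ _ f => 𝔐.ιlog.naturality f }
  ιtimes := 𝔐.ιtimes
  XtoE := 𝔐.XtoE
  NtoE := 𝔐.NtoE
  lamTimes_NtoE := 𝔐.lamTimes_NtoE
  lamPf_NtoE := 𝔐.lamPf_NtoE
  κ := Anab.κAn 𝔐.alg
  AtoE := Anab.proj 𝔐.alg
  κ_equiv := inferInstance
  κ_inv := Iso.refl _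
  φ := 𝔐.φAn
  φ_equiv := 𝔐.φAn_isEquivalence
  η := 𝔐.ηφπ

/-- `id_⋎ = 𝟭_𝒳`. [cite: MochizukiAbsTopIII2015, Corollary 3.6 p.79] -/
theorem toLogFrobeniusData_toNexus : 𝔐.toLogFrobeniusData.toNexus = 𝟭 𝔐.X := rfl

/-- `φ = φ_An`. [cite: MochizukiAbsTopIII2015, Corollary 3.6 (ii) p.79] -/
theorem toLogFrobeniusData_φ : 𝔐.toLogFrobeniusData.φ = 𝔐.φAn := rfl

/-- `κ = κ_An` of Def. 3.1 (vi). [cite: MochizukiAbsTopIII2015, Corollary 3.6 p.78] -/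
theorem toLogFrobeniusData_κ : 𝔐.toLogFrobeniusData.κ = Anab.κAn 𝔐.alg := rfl

/-- **The printed first-row telecore datum `τ = ⟨φ_An, 𝟙, η_An⟩`**: telecore edges `φ_⋎ := φ_An`,
`η_{□⋎}` "the identity natural transformation from the arrow `φ_□ : Anab → 𝒳` to the composite arrow
`id_⋎ ∘ φ_⋎ : Anab → 𝒳`" (here the unitor of `φ_An ⋙ 𝟭`), `η_⋎ := η_An`.
[cite: MochizukiAbsTopIII2015, Corollary 3.6 (ii) pp.79–80] -/
def telecoreData : 𝔐.toLogFrobeniusData.TelecoreData where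
  φ₁ := 𝔐.φAn
  e := 𝔐.φAn.rightUnitor
  η₁ := NatIso.ofComponents (fun x => 𝔐.ηAn.app x) (fun f => 𝔐.ηAn.hom.naturality f)

/-- `φ_⋎ = φ_An`. [cite: MochizukiAbsTopIII2015, Corollary 3.6 (ii) p.79] -/
theorem telecoreData_φ₁ : 𝔐.telecoreData.φ₁ = 𝔐.φAn := rfl

/-- `η_{□⋎}` is the identity: the components of `e` are identities.
[cite: MochizukiAbsTopIII2015, Corollary 3.6 (ii) p.80] -/
@[simp] theorem telecoreData_e_hom_app (a : Anab 𝔐.alg) :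
    𝔐.telecoreData.e.hom.app a = 𝟙 (𝔐.φAn.obj a) := rfl

/-- `η_{□⋎}⁻¹` is the identity. [cite: MochizukiAbsTopIII2015, Corollary 3.6 (ii) p.80] -/
@[simp] theorem telecoreData_e_inv_app (a : Anab 𝔐.alg) :
    𝔐.telecoreData.e.inv.app a = 𝟙 (𝔐.φAn.obj a) := rfl

/-- `η_⋎ = η_An` componentwise. [cite: MochizukiAbsTopIII2015, Corollary 3.6 (ii) p.80] -/
@[simp] theorem telecoreData_η₁_hom_app (x : 𝔐.X) :
    𝔐.telecoreData.η₁.hom.app x = 𝔐.ηAn.hom.app x := rfl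

/-- `id_⋎ = 𝟭` is fully faithful (hypothesis `hν` of `LogFrobeniusData.telecoreStmt_of_coherent`).
[cite: MochizukiAbsTopIII2015, Corollary 3.6 (ii) p.79] -/
def toNexusFullyFaithful : 𝔐.toLogFrobeniusData.toNexus.FullyFaithful := Functor.FullyFaithful.id _

/-- The printed datum is coherent (hypothesis `hτ` of `LogFrobeniusData.telecoreStmt_of_coherent`:
`id_⋎(η_⋎)_x = e ∘ (η_An)_x`, here `η_An = 𝟙 ∘ η_An`). [cite: MochizukiAbsTopIII2015, Corollary 3.6 (ii) p.80] -/
theorem telecoreData_coherent (x : 𝔐.X) :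
    𝔐.toLogFrobeniusData.toNexus.map (𝔐.telecoreData.η₁.hom.app x) =
      𝔐.telecoreData.e.hom.app
          (𝔐.toLogFrobeniusData.κ.obj (𝔐.toLogFrobeniusData.XtoE.obj
            (𝔐.toLogFrobeniusData.toNexus.obj x))) ≫
        𝔐.toLogFrobeniusData.η.hom.app (𝔐.toLogFrobeniusData.toNexus.obj x) := by
  change 𝔐.ηAn.hom.app x = 𝟙 _ ≫ 𝔐.ηAn.hom.app x
  exact (Category.id_comp _).symm

/-! ### Corollary 3.6 (ii) unconditional; Corollary 3.6 (i)–(v) from the two printed inputs -/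

/-- **[AbsTopIII] Cor. 3.6 (ii) at the printed shape of the data — UNCONDITIONAL**: for the
`LogFrobeniusData` built from Def.-3.1-shaped inputs (first row `𝒳`, `id_⋎ = 𝟭`, `Anab`, `κ_An`,
`φ_An`, `η_An` constructed) and the printed telecore datum `⟨φ_An, 𝟙, η_An⟩`, the typed statement
`TelecoreStmt` holds: "`φ_An` gives rise to a telecore structure `𝔗_An` on `𝒟_{≤4}` … the collection
of natural transformations `{η_{□⋎}, η_{□⋎}⁻¹, η_⋏, η_⋏⁻¹}_{⋎ ∈ L, ⋏ ∈ L†}` … generate a contact structure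
`ℋ_An` on the telecore `𝔗_An`".  Proof: `LogFrobeniusData.telecoreStmt_of_coherent` with both its
hypotheses discharged (`toNexusFullyFaithful`, `telecoreData_coherent`).
[cite: MochizukiAbsTopIII2015, Corollary 3.6 (ii) pp.79–80] -/
theorem telecoreStmt : 𝔐.toLogFrobeniusData.TelecoreStmt 𝔐.telecoreData :=
  𝔐.toLogFrobeniusData.telecoreStmt_of_coherent 𝔐.telecoreData 𝔐.toNexusFullyFaithful
    𝔐.telecoreData_coherent

/-- **[AbsTopIII] Cor. 4.5 (ii)** in seat abc-iut-L4-t10's typed form `AbsTopIII.Cor_4_5_ii`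
(literally `TelecoreStmt` on the same abstraction, for archimedean inputs `𝒳 = 𝒞^hol_T`, `LinHol`,
`κ_LH`, `φ_LH`, `η_LH` of the same shape) — unconditional at this shape likewise.  TYPED FORM ONLY:
this records that the typed statement `Cor_4_5_ii` holds for ANY Def.-3.1/4.1-shaped input record;
the archimedean INSTANTIATION of Cor. 4.5 (ii) (the Def. 4.1 (iii)–(v) categories `𝒞^hol_T`, `EA`,
`𝒞^hol_{TH}`, `LinHol` and their functors) lives elsewhere and is not supplied by MLF-shaped data.
[cite: MochizukiAbsTopIII2015, Corollary 4.5 (ii) p.107] -/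
theorem cor_4_5_ii : AbsTopIII.Cor_4_5_ii 𝔐.toLogFrobeniusData 𝔐.telecoreData := 𝔐.telecoreStmt

/-- **Cor. 3.6 (v), first part, from Prop. 3.2 (iv) alone**: "The unique vertex `□` of the second row
of `𝒟` is a nexus of `Γ⃗_𝒟`. Moreover, `𝒟` is totally `□`-rigid" holds as soon as `𝒳 = 𝒞^{MLF-sB}_T` is id-rigid (Prop. 3.2 (iv): "the categories
… `𝒞^{MLF-sB}_T` … are id-rigid") — `id_⋎ = 𝟭` being an equivalence (seat abc-iut-L4-t12's
`nexusRigidStmt_of_isEquivalence`). [cite: MochizukiAbsTopIII2015, Corollary 3.6 (v) pp.80–82] -/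
theorem nexusRigidStmt (hX : IsIdRigid 𝔐.X) : 𝔐.toLogFrobeniusData.NexusRigidStmt :=
  haveI : 𝔐.toLogFrobeniusData.toNexus.IsEquivalence := Functor.isEquivalence_refl
  𝔐.toLogFrobeniusData.nexusRigidStmt_of_isEquivalence hX

/-- The Lemma-3.4 property of the abstract data, unfolded at this shape: no ISOMORPHISM
`a : x ⥲ log(x)` of `𝒳` satisfies `λ^×(a) ∘ ι_{log,x} = ι_{×,x}` (Lemma 3.4, p. 77, is what excludes
this for `𝒞^{MLF-sB}_T`: "we obtain a contradiction to Lemma 3.4", Cor. 3.6 (iv) proof p. 81).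
[cite: MochizukiAbsTopIII2015, Corollary 3.6 (iv) p.81] -/
theorem lemma34Property_iff (ι : 𝔐.lamTimes ⟶ 𝔐.lamPf) :
    LogFrobeniusData.Lemma34Property (Δ := 𝔐.toLogFrobeniusData) ι ↔
      ∀ (x : 𝔐.X) (a : x ⟶ 𝔐.log.obj x), IsIso a →
        𝔐.lamTimes.map a ≫ 𝔐.ιlog.app x ≠ ι.app x :=
  Iff.rfl

/-- **[AbsTopIII] Cor. 3.6 (i)–(v) at the printed shape of the data, from EXACTLY its two printed
model inputs**: for inputs of MLF type (`ι_× : λ^× → λ^{×pf}`) such that no isomorphism `x ⥲ log(x)`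
splits `ι_×` against `ι_log` (Lemma 3.4) and `𝒳 = 𝒞^{MLF-sB}_T` is id-rigid (Prop. 3.2 (iv)), and
`𝒳` has an object, the assembled typed Cor. 3.6 `LogFrobeniusCompatible` holds for the printed
telecore datum: (i) `coreStmt4/5/6`, (ii) `telecoreStmt` (this file, unconditional), (iii)
`observableLogStmt`, (iv) `incompatibleStmt_of_lemma34` / `telecoreIncompatibleStmt_of_lemma34`,
(v) `nexusRigidStmt` (this file) and `shiftStmt`.
[cite: MochizukiAbsTopIII2015, Corollary 3.6 (i)–(v) pp.78–80] -/
theorem logFrobeniusCompatible (ι : 𝔐.lamTimes ⟶ 𝔐.lamPf) (hι : 𝔐.ιtimes = Sum.inl ι)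
    (h34 : ∀ (x : 𝔐.X) (a : x ⟶ 𝔐.log.obj x), IsIso a →
      𝔐.lamTimes.map a ≫ 𝔐.ιlog.app x ≠ ι.app x)
    (hX : IsIdRigid 𝔐.X) (x₀ : 𝔐.X) :
    𝔐.toLogFrobeniusData.LogFrobeniusCompatible 𝔐.telecoreData where
  core4 := 𝔐.toLogFrobeniusData.coreStmt4
  core5 := 𝔐.toLogFrobeniusData.coreStmt5
  core6 := 𝔐.toLogFrobeniusData.coreStmt6
  telecore := 𝔐.telecoreStmt
  observable_log := 𝔐.toLogFrobeniusData.observableLogStmt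
  incompatible_core :=
    𝔐.toLogFrobeniusData.incompatibleStmt_of_lemma34 ι hι x₀ ((𝔐.lemma34Property_iff ι).2 h34)
  incompatible_telecore :=
    𝔐.toLogFrobeniusData.telecoreIncompatibleStmt_of_lemma34 𝔐.telecoreData ι hι
      ((Anab.κAn 𝔐.alg).obj (𝔐.XtoE.obj x₀)) ((𝔐.lemma34Property_iff ι).2 h34)
  nexus_rigid := 𝔐.nexusRigidStmt hX
  shift := 𝔐.toLogFrobeniusData.shiftStmt

end MonoAnabelianLogFrobeniusData

end Literature.AnabelianGeometry.AbsoluteAnabelian
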